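import Literature.AlgebraicGeometry.PlaneCurves.HessianCovariance
import Literature.AlgebraicGeometry.PlaneCurves.WeierstrassNormalForm
import Mathlib.LinearAlgebra.CrossProduct
import HarnessLib

/-!
# Weber's normal form `xy(ax + by + cz) + dz³` of a plane cubic from two inflection tangents (Artebani–Dolgachev, proof of Lemma 1, eq. (4))

Topic `Literature/AlgebraicGeometry/PlaneCurves`, namespace `Literature.AlgebraicGeometry.PlaneCurves`.
Lane `lit-hodgefound`, seat `lit-hodgefound-p37`, row g21-#13; built on `WeierstrassNormalForm` (Q1762:
the ten coefficients of a ternary cubic, `eq_of_isHomogeneous_three`) and `HessianCovariance`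
(`linePoly`, tangents and flexes under a substitution).  ANY field, ANY characteristic.  Everything
here is PROVED; no definition, no named fact.

Source — M. Artebani, I. Dolgachev, *The Hesse pencil of plane cubic curves*, Enseign. Math. (2) 55
(2009), §2, proof of Lemma 1 [`paper:arxiv-math_0611590` p0004 L52–L56], VERBATIM: "We will follow
the arguments from [W].  Let `E` be a nonsingular plane cubic.  Given two inflection tangent lines for
`E` we can choose projective coordinates such that their equations are `x = 0` and `y = 0`.  Then it is
easy to see that the equation of `E` can be written in the form (4) `F(x, y, z) = xy(ax + by + cz) + dz³
= 0`, where `ax + by + cz = 0` is a third inflection tangent line."  (Remark 2.1 then runs the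
characteristic-`3` argument on (4): `HessePencilCharacteristicThreeWebForm/WebSingular/WebNonsingular`.)

## Statement proved

`F` a ternary cubic form over a field `K`; `A, B` two flexes of `{F = 0}` that are distinct points
(`A, B` linearly independent), each regular, with the flex clause of `HessianFlexCriterion` (every
second point `v` of the tangent: `X³ ∣ F(A + Xv)`) and whose tangent line is not a component
(`F(A + Xv) ≠ 0`; automatic for curves without lines).  THEN there is an invertible substitution `M`
with `M(0,1,0) = A`, `M(1,0,0) = B` and `F ∘ M = xy(ax + by + cz) + dz³` for some `a, b, c, d ∈ K`
(`exists_bind₁_eq_web_of_two_flexes`).  The frame: `M = (B | A | E₃)` with `E₃ = ∇F(A) × ∇F(B)` the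
intersection point of the two inflection tangents; in it the tangents are `x = 0` and `y = 0`, and the
flex clauses kill the coefficients of `y³, y²z, yz²` and `x³, x²z, xz²` (§1–§2).

## References
* [ArtebaniDolgachev2009] M. Artebani, I. Dolgachev, *The Hesse pencil of plane cubic curves*,
  Enseign. Math. (2) 55 (2009) 235–273, §2, proof of Lemma 1, eq. (4) (after H. Weber, *Lehrbuch der
  Algebra* II).
* [Knapp1992] A. W. Knapp, *Elliptic Curves*, Princeton 1992, §II.4, (2.20)–(2.22) (the ten
  coefficients; conditions at `(0, 1, 0)`).
* [Gibson1998] C. G. Gibson, *Elementary Geometry of Algebraic Curves*, CUP 1998, Lemma 13.2 (flexes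
  are projectively invariant).
-/

set_option autoImplicit false

open MvPolynomial Matrix
open Literature.AlgebraicGeometry.HyperbolicPolynomials

namespace Literature.AlgebraicGeometry.PlaneCurves

universe u

/-- Exponent vectors `XⁱYʲZᵏ ↦ 𝐦[i, j, k]` on `Fin 3` (local notation as in `WeierstrassNormalForm`). -/
local notation3 "𝐦[" i ", " j ", " k "]" =>
  (Finsupp.single (0 : Fin 3) (i : ℕ) + Finsupp.single (1 : Fin 3) (j : ℕ) +
    Finsupp.single (2 : Fin 3) (k : ℕ) : Fin 3 →₀ ℕ)

/-- The web cubic `xy(ax + by + cz) + dz³` of Lemma 1, eq. (4) (local notation, no definition). -/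
local notation3 "𝐅[" a ", " b ", " c ", " d "]" =>
  (X 0 * X 1 * (C a * X 0 + C b * X 1 + C c * X 2) + C d * X 2 ^ 3 : MvPolynomial (Fin 3) _)

section WeberNormalForm

variable {K : Type u} [Field K] {G F : MvPolynomial (Fin 3) K}

/-! ## §1 The frame `(0,1,0), (1,0,0)` with tangents `x = 0`, `y = 0`: coefficients -/

/-- `G(0, 1, t) = c₀₃₀ + c₀₂₁t + c₀₁₂t² + c₀₀₃t³` — the restriction to the line `x = 0` through
`(0, 1, 0)`. [cite: Knapp1992, §II.4, (2.20) and Prop. 2.9] -/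
theorem linePoly_e₁_e₂ (hG : G.IsHomogeneous 3) :
    linePoly G ![0, 1, 0] ![0, 0, 1] =
      Polynomial.C (coeff 𝐦[0, 3, 0] G) + Polynomial.C (coeff 𝐦[0, 2, 1] G) * Polynomial.X +
        Polynomial.C (coeff 𝐦[0, 1, 2] G) * Polynomial.X ^ 2 +
        Polynomial.C (coeff 𝐦[0, 0, 3] G) * Polynomial.X ^ 3 := by
  conv_lhs => rw [eq_of_isHomogeneous_three hG]
  simp only [linePoly, map_add, map_mul, map_pow, aeval_C, aeval_X, Polynomial.algebraMap_eq]
  simp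

/-- `G(1, 0, t) = c₃₀₀ + c₂₀₁t + c₁₀₂t² + c₀₀₃t³` — the restriction to the line `y = 0` through
`(1, 0, 0)`. [cite: Knapp1992, §II.4, (2.20) and Prop. 2.9] -/
theorem linePoly_e₀_e₂ (hG : G.IsHomogeneous 3) :
    linePoly G ![1, 0, 0] ![0, 0, 1] =
      Polynomial.C (coeff 𝐦[3, 0, 0] G) + Polynomial.C (coeff 𝐦[2, 0, 1] G) * Polynomial.X +
        Polynomial.C (coeff 𝐦[1, 0, 2] G) * Polynomial.X ^ 2 +
        Polynomial.C (coeff 𝐦[0, 0, 3] G) * Polynomial.X ^ 3 := by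
  conv_lhs => rw [eq_of_isHomogeneous_three hG]
  simp only [linePoly, map_add, map_mul, map_pow, aeval_C, aeval_X, Polynomial.algebraMap_eq]
  simp

/-- `X³` divides `α + βX + γX² + δX³` iff `α = β = γ = 0`. [folklore] -/
private theorem X_pow_three_dvd_iff (α β γ δ : K) :
    Polynomial.X ^ 3 ∣ Polynomial.C α + Polynomial.C β * Polynomial.X +
        Polynomial.C γ * Polynomial.X ^ 2 + Polynomial.C δ * Polynomial.X ^ 3 ↔
      α = 0 ∧ β = 0 ∧ γ = 0 := by
  rw [Polynomial.X_pow_dvd_iff]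
  constructor
  · intro h
    have h0 := h 0 (by norm_num)
    have h1 := h 1 (by norm_num)
    have h2 := h 2 (by norm_num)
    simp [Polynomial.coeff_C, Polynomial.coeff_X_pow] at h0 h1 h2
    exact ⟨h0, h1, h2⟩
  · rintro ⟨rfl, rfl, rfl⟩ d hd
    interval_cases d <;>
      simp [Polynomial.coeff_C, Polynomial.coeff_X_pow]

/-- **"it is easy to see that the equation of `E` can be written in the form (4)"** — the coefficient
step: a ternary cubic `G` with `X³ ∣ G(0, 1, t)` and `X³ ∣ G(1, 0, t)` (the lines `x = 0` and `y = 0`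
meet `{G = 0}` only at `(0, 1, 0)` and `(1, 0, 0)`, triply) IS `xy(ax + by + cz) + dz³` with
`(a, b, c, d) = (c₂₁₀, c₁₂₀, c₁₁₁, c₀₀₃)`. [cite: ArtebaniDolgachev2009, §2, proof of Lemma 1, eq. (4)] -/
theorem eq_web_of_linePoly_dvd (hG : G.IsHomogeneous 3)
    (h1 : Polynomial.X ^ 3 ∣ linePoly G ![0, 1, 0] ![0, 0, 1])
    (h0 : Polynomial.X ^ 3 ∣ linePoly G ![1, 0, 0] ![0, 0, 1]) :
    G = 𝐅[coeff 𝐦[2, 1, 0] G, coeff 𝐦[1, 2, 0] G, coeff 𝐦[1, 1, 1] G, coeff 𝐦[0, 0, 3] G] := by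
  rw [linePoly_e₁_e₂ hG, X_pow_three_dvd_iff] at h1
  rw [linePoly_e₀_e₂ hG, X_pow_three_dvd_iff] at h0
  obtain ⟨h030, h021, h012⟩ := h1
  obtain ⟨h300, h201, h102⟩ := h0
  conv_lhs => rw [eq_of_isHomogeneous_three hG]
  rw [h030, h021, h012, h300, h201, h102]
  simp only [map_zero, zero_mul, zero_add, add_zero]
  ring

/-! ## §2 The frame from two flexes -/

/-- Euler at a point of the curve: `⟨∇F(A), A⟩ = 3F(A) = 0`. [cite: Kunz2005PlaneAlgebraicCurves, Ch. 9,
Lemma 9.5 (Euler's formula)] -/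
private theorem grad_dotProduct_self_eq_zero (hF : F.IsHomogeneous 3) {A : Fin 3 → K}
    (hA : eval A F = 0) : (fun j => eval A (pderiv j F)) ⬝ᵥ A = 0 := by
  rw [dotProduct_comm, dotProduct_eval_pderiv hF, hA, mul_zero]

/-- **An inflection tangent does not pass through a second point of the curve**: if `A` is a flex whose
tangent line is not a component and `B ≠ A` lies on `{F = 0}`, then `⟨∇F(A), B⟩ ≠ 0` (else the line
`AB` is the tangent at `A`: `F(A + tB) = t³F(B) + …` is divisible by `t³` and has leading coefficient
`F(B) = 0`, so it vanishes). [cite: ArtebaniDolgachev2009, §2, proof of Lemma 1 ("Given two inflection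
tangent lines")] [cite: Knapp1992, §II.3, Prop. 2.9] -/
theorem grad_dotProduct_ne_zero_of_flex (hF : F.IsHomogeneous 3) {A B : Fin 3 → K}
    (hfA : ∀ v, (fun j => eval A (pderiv j F)) ⬝ᵥ v = 0 → LinearIndependent K ![A, v] →
      Polynomial.X ^ 3 ∣ linePoly F A v)
    (hcompA : ∀ v, (fun j => eval A (pderiv j F)) ⬝ᵥ v = 0 → LinearIndependent K ![A, v] →
      linePoly F A v ≠ 0)
    (hB : eval B F = 0) (hAB : LinearIndependent K ![A, B]) :
    (fun j => eval A (pderiv j F)) ⬝ᵥ B ≠ 0 := by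
  intro h
  have hdvd := hfA B h hAB
  apply hcompA B h hAB
  rw [Polynomial.X_pow_dvd_iff] at hdvd
  have hdeg := natDegree_linePoly_le hF A B
  have h3 : (linePoly F A B).coeff 3 = 0 := by rw [coeff_linePoly_eq_eval hF A B, hB]
  ext k
  rw [Polynomial.coeff_zero]
  rcases lt_or_ge k 3 with hk | hk
  · exact hdvd k hk
  · rcases eq_or_lt_of_le hk with hk3 | hk3
    · rw [← hk3]; exact h3
    · exact Polynomial.coeff_eq_zero_of_natDegree_lt (lt_of_le_of_lt hdeg hk3)

/-- **Weber's frame.**  For two flexes `A, B` (distinct, regular, tangents not components) put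
`E₃ = ∇F(A) × ∇F(B)` (the common point of the two inflection tangents) and `M = (B | A | E₃)`
(columns).  Then `M(1,0,0) = B`, `M(0,1,0) = A`, `M(0,0,1) = E₃`, `det M ≠ 0`, and in the new
coordinates the tangent at `(0,1,0)` is `x = 0` and the tangent at `(1,0,0)` is `y = 0`:
`⟨∇F(A), E₃⟩ = ⟨∇F(B), E₃⟩ = 0`, `⟨∇F(A), A⟩ = ⟨∇F(B), B⟩ = 0`. [cite: ArtebaniDolgachev2009, §2,
proof of Lemma 1 ("we can choose projective coordinates such that their equations are `x = 0` and
`y = 0`")] -/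
theorem weber_frame (hF : F.IsHomogeneous 3) {A B : Fin 3 → K}
    (hA : eval A F = 0)
    (hfA : ∀ v, (fun j => eval A (pderiv j F)) ⬝ᵥ v = 0 → LinearIndependent K ![A, v] →
      Polynomial.X ^ 3 ∣ linePoly F A v)
    (hcompA : ∀ v, (fun j => eval A (pderiv j F)) ⬝ᵥ v = 0 → LinearIndependent K ![A, v] →
      linePoly F A v ≠ 0)
    (hB : eval B F = 0)
    (hfB : ∀ v, (fun j => eval B (pderiv j F)) ⬝ᵥ v = 0 → LinearIndependent K ![B, v] →
      Polynomial.X ^ 3 ∣ linePoly F B v)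
    (hcompB : ∀ v, (fun j => eval B (pderiv j F)) ⬝ᵥ v = 0 → LinearIndependent K ![B, v] →
      linePoly F B v ≠ 0)
    (hAB : LinearIndependent K ![A, B]) {E₃ : Fin 3 → K}
    (hE₃ : E₃ = crossProduct (fun j => eval A (pderiv j F)) (fun j => eval B (pderiv j F)))
    {M : Matrix (Fin 3) (Fin 3) K}
    (hM : M = Matrix.of fun i j => (![B, A, E₃] : Fin 3 → Fin 3 → K) j i) :
    M *ᵥ ![1, 0, 0] = B ∧ M *ᵥ ![0, 1, 0] = A ∧ M *ᵥ ![0, 0, 1] = E₃ ∧ M.det ≠ 0 ∧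
      (fun j => eval A (pderiv j F)) ⬝ᵥ E₃ = 0 ∧ (fun j => eval B (pderiv j F)) ⬝ᵥ E₃ = 0 ∧
      LinearIndependent K ![A, E₃] ∧ LinearIndependent K ![B, E₃] := by
  subst hM
  have hBA : LinearIndependent K ![B, A] := by
    rw [LinearIndependent.pair_iff] at hAB ⊢
    intro s t h
    have := hAB t s (by rw [add_comm]; exact h)
    exact ⟨this.2, this.1⟩
  have hgAB := grad_dotProduct_ne_zero_of_flex hF hfA hcompA hB hAB
  have hgBA := grad_dotProduct_ne_zero_of_flex hF hfB hcompB hA hBA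
  have hgAA := grad_dotProduct_self_eq_zero hF hA
  have hgBB := grad_dotProduct_self_eq_zero hF hB
  have hAE : (fun j => eval A (pderiv j F)) ⬝ᵥ E₃ = 0 := by rw [hE₃]; exact dot_self_cross _ _
  have hBE : (fun j => eval B (pderiv j F)) ⬝ᵥ E₃ = 0 := by rw [hE₃]; exact dot_cross_self _ _
  have hM0 : (Matrix.of fun i j => (![B, A, E₃] : Fin 3 → Fin 3 → K) j i) *ᵥ ![1, 0, 0] = B := by
    funext i; simp [Matrix.mulVec, dotProduct, Fin.sum_univ_three]
  have hM1 : (Matrix.of fun i j => (![B, A, E₃] : Fin 3 → Fin 3 → K) j i) *ᵥ ![0, 1, 0] = A := by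
    funext i; simp [Matrix.mulVec, dotProduct, Fin.sum_univ_three]
  have hM2 : (Matrix.of fun i j => (![B, A, E₃] : Fin 3 → Fin 3 → K) j i) *ᵥ ![0, 0, 1] = E₃ := by
    funext i; simp [Matrix.mulVec, dotProduct, Fin.sum_univ_three]
  -- `E₃ ≠ 0`: the two gradients are not parallel (`A` is on the first tangent, not on the second)
  have hE0 : E₃ ≠ 0 := by
    rw [hE₃]
    refine crossProduct_ne_zero_iff_linearIndependent.2 ?_
    rw [LinearIndependent.pair_iff]
    intro s t h
    have hA' := congrArg (fun w => w ⬝ᵥ A) h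
    simp only [add_dotProduct, smul_dotProduct, hgAA, smul_eq_mul, mul_zero, zero_add,
      zero_dotProduct] at hA'
    have ht : t = 0 := (mul_eq_zero.1 hA').resolve_right hgBA
    rw [ht, zero_smul, add_zero] at h
    have hB' := congrArg (fun w => w ⬝ᵥ B) h
    simp only [smul_dotProduct, smul_eq_mul, zero_dotProduct] at hB'
    exact ⟨(mul_eq_zero.1 hB').resolve_right hgAB, ht⟩
  -- a general linear combination `w₀B + w₁A + w₂E₃ = 0` is trivial
  have hcomb : ∀ w : Fin 3 → K, w 0 • B + w 1 • A + w 2 • E₃ = 0 → w = 0 := by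
    intro w h
    have hA' := congrArg (fun u => (fun j => eval A (pderiv j F)) ⬝ᵥ u) h
    simp only [dotProduct_add, dotProduct_smul, hgAA, hAE, smul_eq_mul, mul_zero, add_zero,
      dotProduct_zero] at hA'
    have h0 : w 0 = 0 := (mul_eq_zero.1 hA').resolve_right hgAB
    have hB' := congrArg (fun u => (fun j => eval B (pderiv j F)) ⬝ᵥ u) h
    simp only [dotProduct_add, dotProduct_smul, hgBB, hBE, smul_eq_mul, mul_zero, add_zero,
      zero_add, dotProduct_zero, h0] at hB'
    have h1 : w 1 = 0 := (mul_eq_zero.1 hB').resolve_right hgBA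
    rw [h0, h1, zero_smul, zero_smul, zero_add, zero_add] at h
    have h2 : w 2 = 0 := (smul_eq_zero.1 h).resolve_right hE0
    funext i; fin_cases i
    · exact h0
    · exact h1
    · exact h2
  have hMv : ∀ w : Fin 3 → K, (Matrix.of fun i j => (![B, A, E₃] : Fin 3 → Fin 3 → K) j i) *ᵥ w =
      w 0 • B + w 1 • A + w 2 • E₃ := by
    intro w; funext i
    simp [Matrix.mulVec, dotProduct, Fin.sum_univ_three]
    ring
  have hdet : (Matrix.of fun i j => (![B, A, E₃] : Fin 3 → Fin 3 → K) j i).det ≠ 0 := by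
    intro hd
    obtain ⟨w, hw0, hw⟩ := Matrix.exists_mulVec_eq_zero_iff.2 hd
    exact hw0 (hcomb w (by rw [← hMv]; exact hw))
  have hAE₃ : LinearIndependent K ![A, E₃] := by
    rw [LinearIndependent.pair_iff]
    intro s t h
    have := hcomb ![0, s, t] (by simpa using h)
    exact ⟨by simpa using congrFun this 1, by simpa using congrFun this 2⟩
  have hBE₃ : LinearIndependent K ![B, E₃] := by
    rw [LinearIndependent.pair_iff]
    intro s t h
    have := hcomb ![s, 0, t] (by simpa using h)
    exact ⟨by simpa using congrFun this 0, by simpa using congrFun this 2⟩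
  exact ⟨hM0, hM1, hM2, hdet, hAE, hBE, hAE₃, hBE₃⟩

/-! ## §3 Weber's normal form -/

/-- **Artebani–Dolgachev (after Weber), proof of Lemma 1: "Given two inflection tangent lines for `E`
we can choose projective coordinates such that their equations are `x = 0` and `y = 0`.  Then […] the
equation of `E` can be written in the form `F(x, y, z) = xy(ax + by + cz) + dz³ = 0`."**  Any field:
for a ternary cubic form `F` and two flexes `A ≠ B` of `{F = 0}` (regularity is not even needed here;
the flex clause and "the tangent is not a component" are), there is an invertible `M` with
`M(0,1,0) = A`, `M(1,0,0) = B` and `F ∘ M = xy(ax + by + cz) + dz³`. [cite: ArtebaniDolgachev2009, §2,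
proof of Lemma 1, eq. (4)] -/
theorem exists_bind₁_eq_web_of_two_flexes (hF : F.IsHomogeneous 3) {A B : Fin 3 → K}
    (hA : eval A F = 0)
    (hfA : ∀ v, (fun j => eval A (pderiv j F)) ⬝ᵥ v = 0 → LinearIndependent K ![A, v] →
      Polynomial.X ^ 3 ∣ linePoly F A v)
    (hcompA : ∀ v, (fun j => eval A (pderiv j F)) ⬝ᵥ v = 0 → LinearIndependent K ![A, v] →
      linePoly F A v ≠ 0)
    (hB : eval B F = 0)
    (hfB : ∀ v, (fun j => eval B (pderiv j F)) ⬝ᵥ v = 0 → LinearIndependent K ![B, v] →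
      Polynomial.X ^ 3 ∣ linePoly F B v)
    (hcompB : ∀ v, (fun j => eval B (pderiv j F)) ⬝ᵥ v = 0 → LinearIndependent K ![B, v] →
      linePoly F B v ≠ 0)
    (hAB : LinearIndependent K ![A, B]) :
    ∃ (M : Matrix (Fin 3) (Fin 3) K) (a b c d : K), M.det ≠ 0 ∧ M *ᵥ ![0, 1, 0] = A ∧
      M *ᵥ ![1, 0, 0] = B ∧ bind₁ M.toMvPolynomial F = 𝐅[a, b, c, d] := by
  set E₃ : Fin 3 → K := crossProduct (fun j => eval A (pderiv j F)) (fun j => eval B (pderiv j F))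
    with hE₃
  set M : Matrix (Fin 3) (Fin 3) K := Matrix.of fun i j => (![B, A, E₃] : Fin 3 → Fin 3 → K) j i
    with hM
  obtain ⟨hM0, hM1, hM2, hdet, hAE, hBE, hAE₃, hBE₃⟩ :=
    weber_frame hF hA hfA hcompA hB hfB hcompB hAB hE₃ hM
  set G := bind₁ M.toMvPolynomial F with hG_def
  have hG : G.IsHomogeneous 3 := isHomogeneous_bind₁_toMvPolynomial hF M
  -- the two restrictions in the new frame are `F(A + t E₃)`, `F(B + t E₃)`
  have h1 : Polynomial.X ^ 3 ∣ linePoly G ![0, 1, 0] ![0, 0, 1] := by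
    rw [hG_def, linePoly_bind₁_toMvPolynomial, hM1, hM2]
    exact hfA E₃ hAE hAE₃
  have h0 : Polynomial.X ^ 3 ∣ linePoly G ![1, 0, 0] ![0, 0, 1] := by
    rw [hG_def, linePoly_bind₁_toMvPolynomial, hM0, hM2]
    exact hfB E₃ hBE hBE₃
  exact ⟨M, _, _, _, _, hdet, hM1, hM0, eq_web_of_linePoly_dvd hG h1 h0⟩

end WeberNormalForm

end Literature.AlgebraicGeometry.PlaneCurves
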